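import Literature.RingTheory.MvPowerSeries.FiniteColength
import Literature.RingTheory.Length.ColengthFinrank

/-!
# Route `JacobianBudget`, crux `IsolatedJacobianDrop` (stmt-ResolutionOfSingularities-18946), line
# `euler-noether`: helper kit for stub `stub_baseChange` (S1) — the colength of an ideal of `κ⟦x⟧`
# is invariant under extension of the ground field

For a field extension `κ → L` (any `Algebra κ L` between fields), finitely many variables `σ`, and
ANY ideal `J` of `R_κ = MvPowerSeries σ κ`, write `ψ = MvPowerSeries.map (algebraMap κ L)` for the
coefficientwise extension of scalars `R_κ → R_L` and `J_L = J.map ψ` for the extended ideal. We prove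

* `finite_iff_map` : `R_κ ⧸ J` is finite over `κ` iff `R_L ⧸ J_L` is finite over `L`;
* `finrank_eq_map` : `dim_κ (R_κ ⧸ J) = dim_L (R_L ⧸ J_L)`

(and the same against a named extended ideal: `finite_iff`, `finrank_eq`).

Argument (elementary; no tensor products — `L⟦x⟧` is NOT `L ⊗_κ κ⟦x⟧` unless `L/κ` is finite,
but the two agree modulo every power of the maximal ideal).
* The engine is the coefficientwise extension `λ̂ : R_L → R_κ` of a `κ`-linear functional
  `λ : L → κ` (`exists_hat`; used through its coefficient description): it is `R_κ`-linear in the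
  sense `λ̂ (h · ψ g) = λ̂ h · g` (`hat_mul_map`: the coefficient of a product is a finite sum over
  the antidiagonal, and `λ (y · φ a) = λ y · a`), `λ̂ (ℓ • ψ g) = λ ℓ • g` (`hat_smul_map`), hence
  `λ̂ (J_L) ⊆ J` (`hat_mem`). With `λ = ρ` a `κ`-linear retraction of `κ → L` this gives
  `ψ⁻¹ (J_L) = J` (`comap_map`): extended ideals are contracted faithfully.
* `𝔪_K ^ N` is the set of series with no coefficients in degree `< N`
  (`Jets.mem_maximalIdeal_pow_iff`), so `ψ f ∈ 𝔪_L ^ N ↔ f ∈ 𝔪_κ ^ N`, `𝔪_κ ^ N ≤ J ⇒ 𝔪_L ^ N ≤ J_L`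
  (monomial generators) and `𝔪_L ^ N ≤ J_L ⇒ 𝔪_κ ^ N ≤ J` (contraction). Finite colength means
  containing a power of `𝔪` (`Jets.exists_maximalIdeal_pow_le_of_finite_quotient`,
  `Jets.finite_quotient_maximalIdeal_pow`, `Length.finite_quotient_of_le`): `finite_iff_map`.
* Dimensions, in the finite case, with `Φ : R_κ ⧸ J → R_L ⧸ J_L` the induced `κ`-linear map
  (`exists_quotMap`): the `L`-span of the image of `Φ` is everything (`span_range_quotMap`: every
  series is a polynomial modulo `𝔪_L ^ N ≤ J_L`, and `L`-polynomials are `L`-combinations of the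
  monomials `ψ (xᵉ)`), so the image of a `κ`-basis spans and `dim_L ≤ dim_κ` (`finrank_map_le`);
  conversely the image of a `κ`-basis is `L`-free (`le_finrank_map`): apply every `λ̂` to an
  `L`-relation to get `κ`-relations with coefficients `λ (ℓ_k)`, and functionals separate the
  points of `L` (`Module.forall_dual_apply_eq_zero_iff`). In the infinite case both `finrank`s
  vanish.

This is the standard "Milnor/Tjurina numbers are invariant under extension of the base field" (flat
base change `κ⟦x⟧ → L⟦x⟧` of an `𝔪`-primary ideal), e.g. Greuel–Lossen–Shustin, *Introduction to
Singularities and Deformations* (2007), §I.1; here proved from scratch over the tree's jet kit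
(`Literature/RingTheory/MvPowerSeries/MaximalIdealPow.lean`, `FiniteColength.lean`). No definitions.
[folklore]
-/

noncomputable section

set_option linter.dupNamespace false

open scoped BigOperators Classical

namespace Summit.ResolutionOfSingularities.ResolutionOfSingularities.Theorems.JacobianBudget

namespace BaseChange

open MvPowerSeries IsLocalRing Module
open Literature.RingTheory.MvPowerSeries.Jets Literature.RingTheory.Length

variable {σ : Type*} {κ L : Type*} [Field κ] [Field L] [Algebra κ L]

/-! ## The coefficientwise extension `λ̂` of a `κ`-linear functional `λ : L → κ` -/

/-- The coefficientwise extension `λ̂ : L⟦x⟧ → κ⟦x⟧` of a `κ`-linear functional `λ : L → κ`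
exists as a `κ`-linear map. [folklore] -/
theorem exists_hat (lam : L →ₗ[κ] κ) :
    ∃ Λ : MvPowerSeries σ L →ₗ[κ] MvPowerSeries σ κ,
      ∀ (h : MvPowerSeries σ L) (e : σ →₀ ℕ), coeff e (Λ h) = lam (coeff e h) :=
  ⟨{ toFun := fun h e => lam (h e)
     map_add' := fun h h' => funext fun e => map_add lam (h e) (h' e)
     map_smul' := fun a h => funext fun e => map_smul lam a (h e) }, fun _ _ => rfl⟩

variable {lam : L →ₗ[κ] κ} {Λ : MvPowerSeries σ L →ₗ[κ] MvPowerSeries σ κ}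

/-- **`λ̂` is `κ⟦x⟧`-linear**: `λ̂ (h · ψ g) = λ̂ h · g` (the coefficient of a product is a finite
sum over the antidiagonal, and `λ (y · φ a) = λ y · a`). [folklore] -/
theorem hat_mul_map (hΛ : ∀ (h : MvPowerSeries σ L) (e : σ →₀ ℕ), coeff e (Λ h) = lam (coeff e h))
    (h : MvPowerSeries σ L) (g : MvPowerSeries σ κ) :
    Λ (h * map (algebraMap κ L) g) = Λ h * g := by
  ext e
  rw [hΛ, coeff_mul, coeff_mul, map_sum]
  refine Finset.sum_congr rfl fun x _ => ?_
  rw [coeff_map, hΛ, ← Algebra.commutes, ← Algebra.smul_def, map_smul, smul_eq_mul]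
  exact mul_comm _ _

/-- `λ̂ (ℓ • ψ g) = λ ℓ • g`. [folklore] -/
theorem hat_smul_map (hΛ : ∀ (h : MvPowerSeries σ L) (e : σ →₀ ℕ), coeff e (Λ h) = lam (coeff e h))
    (l : L) (g : MvPowerSeries σ κ) :
    Λ (l • map (algebraMap κ L) g) = lam l • g := by
  ext e
  rw [hΛ]
  show lam (l * algebraMap κ L (coeff e g)) = lam l * coeff e g
  rw [← Algebra.commutes, ← Algebra.smul_def, map_smul, smul_eq_mul]
  exact mul_comm _ _

/-- **`λ̂` maps the extended ideal `J_L = J.map ψ` back into `J`.** [folklore] -/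
theorem hat_mem (hΛ : ∀ (h : MvPowerSeries σ L) (e : σ →₀ ℕ), coeff e (Λ h) = lam (coeff e h))
    (J : Ideal (MvPowerSeries σ κ)) {x : MvPowerSeries σ L}
    (hx : x ∈ J.map (map (algebraMap κ L))) : Λ x ∈ J := by
  suffices key : ∀ h : MvPowerSeries σ L, Λ (h * x) ∈ J by
    simpa only [one_mul] using key 1
  refine Submodule.span_induction (p := fun x _ => ∀ h : MvPowerSeries σ L, Λ (h * x) ∈ J)
    ?_ ?_ ?_ ?_ hx
  · rintro _ ⟨g, hg, rfl⟩ h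
    rw [hat_mul_map hΛ]
    exact J.mul_mem_left _ hg
  · intro h
    rw [mul_zero, map_zero]
    exact J.zero_mem
  · intro x y _ _ hx hy h
    rw [mul_add, map_add]
    exact J.add_mem (hx h) (hy h)
  · intro a x _ hx h
    rw [smul_eq_mul, ← mul_assoc]
    exact hx (h * a)

/-- A `κ`-linear retraction of the structure map `κ → L` exists. [folklore] -/
theorem exists_retraction : ∃ ρ : L →ₗ[κ] κ, ∀ a : κ, ρ (algebraMap κ L a) = a := by
  obtain ⟨ρ, hρ⟩ := LinearMap.exists_leftInverse_of_injective (Algebra.linearMap κ L)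
    (LinearMap.ker_eq_bot.mpr (algebraMap κ L).injective)
  exact ⟨ρ, fun a => by simpa using LinearMap.congr_fun hρ a⟩

/-- For a retraction `ρ` of `κ → L`, `ρ̂ ∘ ψ = id`. [folklore] -/
theorem hat_map_of_retraction
    (hΛ : ∀ (h : MvPowerSeries σ L) (e : σ →₀ ℕ), coeff e (Λ h) = lam (coeff e h))
    (hρ : ∀ a : κ, lam (algebraMap κ L a) = a) (g : MvPowerSeries σ κ) :
    Λ (map (algebraMap κ L) g) = g := by
  ext e
  rw [hΛ, coeff_map]
  exact hρ _

/-- **Extended ideals are contracted faithfully**: `ψ⁻¹ (J.map ψ) = J`. [folklore] -/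
theorem comap_map (J : Ideal (MvPowerSeries σ κ)) :
    (J.map (map (algebraMap κ L))).comap (map (algebraMap κ L)) = J := by
  refine le_antisymm (fun g hg => ?_) Ideal.le_comap_map
  obtain ⟨ρ, hρ⟩ := exists_retraction (κ := κ) (L := L)
  obtain ⟨Λ, hΛ⟩ := exists_hat (σ := σ) ρ
  rw [Ideal.mem_comap] at hg
  have := hat_mem hΛ J hg
  rwa [hat_map_of_retraction hΛ hρ] at this

/-! ## Powers of the maximal ideal under `ψ`; finiteness of the colength is invariant -/

section Finite

variable [Finite σ]

/-- `ψ f ∈ 𝔪_L ^ N ↔ f ∈ 𝔪_κ ^ N` (both mean: no coefficients in degree `< N`). [folklore] -/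
theorem map_mem_maximalIdeal_pow_iff {N : ℕ} {g : MvPowerSeries σ κ} :
    map (algebraMap κ L) g ∈ maximalIdeal (MvPowerSeries σ L) ^ N ↔
      g ∈ maximalIdeal (MvPowerSeries σ κ) ^ N := by
  simp only [mem_maximalIdeal_pow_iff, coeff_map, map_eq_zero_iff _ (algebraMap κ L).injective]

/-- `𝔪_κ ^ N ≤ J ⇒ 𝔪_L ^ N ≤ J.map ψ` (the monomial generators of `𝔪_L ^ N` are `ψ`-images).
[folklore] -/
theorem maximalIdeal_pow_le_map {N : ℕ} {J : Ideal (MvPowerSeries σ κ)}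
    (h : maximalIdeal (MvPowerSeries σ κ) ^ N ≤ J) :
    maximalIdeal (MvPowerSeries σ L) ^ N ≤ J.map (map (algebraMap κ L)) := by
  rw [maximalIdeal_pow_eq_span_monomial, Ideal.span_le]
  rintro _ ⟨e, he, rfl⟩
  have he' : e.degree = N := he
  show monomial e (1 : L) ∈ J.map (map (algebraMap κ L))
  have hmon : monomial e (1 : L) = map (algebraMap κ L) (monomial e 1) := by
    rw [map_monomial, (algebraMap κ L).map_one]
  rw [hmon]
  exact Ideal.mem_map_of_mem _ (h (monomial_mem_maximalIdeal_pow (le_of_eq he'.symm) 1))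

/-- `𝔪_L ^ N ≤ J.map ψ ⇒ 𝔪_κ ^ N ≤ J` (contraction, `comap_map`). [folklore] -/
theorem maximalIdeal_pow_le_of_map {N : ℕ} {J : Ideal (MvPowerSeries σ κ)}
    (h : maximalIdeal (MvPowerSeries σ L) ^ N ≤ J.map (map (algebraMap κ L))) :
    maximalIdeal (MvPowerSeries σ κ) ^ N ≤ J := by
  intro g hg
  rw [← comap_map (L := L) J, Ideal.mem_comap]
  exact h (map_mem_maximalIdeal_pow_iff.mpr hg)

/-- **Finite colength is invariant under extension of the ground field**: `R_κ ⧸ J` is finite over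
`κ` iff `R_L ⧸ J.map ψ` is finite over `L`. [folklore] -/
theorem finite_iff_map (J : Ideal (MvPowerSeries σ κ)) :
    Module.Finite κ (MvPowerSeries σ κ ⧸ J) ↔
      Module.Finite L (MvPowerSeries σ L ⧸ J.map (map (algebraMap κ L))) := by
  constructor
  · intro hfin
    obtain ⟨N, hN⟩ := exists_maximalIdeal_pow_le_of_finite_quotient J
    haveI := finite_quotient_maximalIdeal_pow (σ := σ) (K := L) N
    exact finite_quotient_of_le (κ := L) (maximalIdeal_pow_le_map hN)
  · intro hfin
    obtain ⟨N, hN⟩ :=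
      exists_maximalIdeal_pow_le_of_finite_quotient (J.map (map (algebraMap κ L)))
    haveI := finite_quotient_maximalIdeal_pow (σ := σ) (K := κ) N
    exact finite_quotient_of_le (κ := κ) (maximalIdeal_pow_le_of_map hN)

end Finite

/-! ## The colength is invariant -/

/-- The `κ`-linear map `Φ : R_κ ⧸ J → R_L ⧸ J.map ψ`, `[f] ↦ [ψ f]`, exists. [folklore] -/
theorem exists_quotMap (J : Ideal (MvPowerSeries σ κ)) :
    ∃ Φ : (MvPowerSeries σ κ ⧸ J) →ₗ[κ] (MvPowerSeries σ L ⧸ J.map (map (algebraMap κ L))),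
      ∀ f : MvPowerSeries σ κ, Φ (Ideal.Quotient.mk J f) =
        Ideal.Quotient.mk (J.map (map (algebraMap κ L))) (map (algebraMap κ L) f) :=
  ⟨(Ideal.quotientMapₐ (J.map (map (algebraMap κ L))) (mapAlgHom (σ := σ) (Algebra.ofId κ L))
      fun _ hx => Ideal.mem_comap.mpr (Ideal.mem_map_of_mem _ hx)).toLinearMap, fun _ => rfl⟩

variable {J : Ideal (MvPowerSeries σ κ)}
  {Φ : (MvPowerSeries σ κ ⧸ J) →ₗ[κ] (MvPowerSeries σ L ⧸ J.map (map (algebraMap κ L)))}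

section Finite

variable [Finite σ]

/-- **Jets: in the finite case the `L`-span of the image of `Φ` is everything** (every series is
a polynomial modulo `𝔪_L ^ N ≤ J_L`, and `L`-polynomials are `L`-combinations of the monomials
`ψ (xᵉ)`). [folklore] -/
theorem span_range_quotMap
    (hΦ : ∀ f : MvPowerSeries σ κ, Φ (Ideal.Quotient.mk J f) =
      Ideal.Quotient.mk (J.map (map (algebraMap κ L))) (map (algebraMap κ L) f))
    {N : ℕ} (hN : maximalIdeal (MvPowerSeries σ L) ^ N ≤ J.map (map (algebraMap κ L))) :
    Submodule.span L (Set.range Φ) = ⊤ := by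
  rw [eq_top_iff]
  rintro x -
  obtain ⟨h, rfl⟩ := Ideal.Quotient.mk_surjective x
  have hh : Ideal.Quotient.mk (J.map (map (algebraMap κ L))) h =
      Ideal.Quotient.mk _ (↑(truncTotal N h) : MvPowerSeries σ L) := by
    rw [Ideal.Quotient.eq]
    exact hN (sub_coe_truncTotal_mem_maximalIdeal_pow N h)
  have hterm : ∀ (e : σ →₀ ℕ) (a : L),
      Ideal.Quotient.mk (J.map (map (algebraMap κ L))) (monomial e a) =
        a • Φ (Ideal.Quotient.mk J (monomial e 1)) := by
    intro e a
    have hmon : monomial e a = a • monomial e (1 : L) := by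
      rw [← map_smul, smul_eq_mul, mul_one]
    rw [hΦ, map_monomial, (algebraMap κ L).map_one, hmon, ← Ideal.Quotient.mkₐ_eq_mk L,
      map_smul]
  rw [hh, (truncTotal N h).as_sum, ← MvPolynomial.coeToMvPowerSeries.ringHom_apply, map_sum,
    map_sum]
  refine Submodule.sum_mem _ fun e _ => ?_
  rw [MvPolynomial.coeToMvPowerSeries.ringHom_apply, MvPolynomial.coe_monomial, hterm]
  exact Submodule.smul_mem _ _ (Submodule.subset_span ⟨_, rfl⟩)

/-- **Upper bound**: in the finite case `dim_L (R_L ⧸ J_L) ≤ dim_κ (R_κ ⧸ J)` (the image of a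
`κ`-basis spans over `L`). [folklore] -/
theorem finrank_map_le
    (hΦ : ∀ f : MvPowerSeries σ κ, Φ (Ideal.Quotient.mk J f) =
      Ideal.Quotient.mk (J.map (map (algebraMap κ L))) (map (algebraMap κ L) f))
    {N : ℕ} (hN : maximalIdeal (MvPowerSeries σ L) ^ N ≤ J.map (map (algebraMap κ L)))
    [Module.Finite κ (MvPowerSeries σ κ ⧸ J)] :
    finrank L (MvPowerSeries σ L ⧸ J.map (map (algebraMap κ L))) ≤
      finrank κ (MvPowerSeries σ κ ⧸ J) := by
  set b := Module.finBasis κ (MvPowerSeries σ κ ⧸ J)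
  have hspan : Submodule.span L (Set.range fun k => Φ (b k)) = ⊤ := by
    apply eq_top_iff.mpr
    rw [← span_range_quotMap hΦ hN, Submodule.span_le]
    rintro _ ⟨q, rfl⟩
    have hq : q ∈ Submodule.span κ (Set.range b) := by
      rw [b.span_eq]; exact Submodule.mem_top
    have hq' := Submodule.apply_mem_span_image_of_mem_span Φ hq
    rw [← Set.range_comp] at hq'
    exact Submodule.span_le_restrictScalars κ L _ hq'
  have h := finrank_range_le_card (R := L) fun k => Φ (b k)
  unfold Set.finrank at h
  rw [hspan, finrank_top] at h
  simpa using h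

omit [Finite σ] in
/-- **Lower bound**: in the finite case `dim_κ (R_κ ⧸ J) ≤ dim_L (R_L ⧸ J_L)` (the image of a
`κ`-basis is `L`-free: apply every `λ̂` to an `L`-relation and use that functionals separate
the points of `L`). [folklore] -/
theorem le_finrank_map
    (hΦ : ∀ f : MvPowerSeries σ κ, Φ (Ideal.Quotient.mk J f) =
      Ideal.Quotient.mk (J.map (map (algebraMap κ L))) (map (algebraMap κ L) f))
    [Module.Finite κ (MvPowerSeries σ κ ⧸ J)]
    [Module.Finite L (MvPowerSeries σ L ⧸ J.map (map (algebraMap κ L)))] :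
    finrank κ (MvPowerSeries σ κ ⧸ J) ≤
      finrank L (MvPowerSeries σ L ⧸ J.map (map (algebraMap κ L))) := by
  set b := Module.finBasis κ (MvPowerSeries σ κ ⧸ J)
  obtain ⟨f, hf⟩ : ∃ f : Fin (finrank κ (MvPowerSeries σ κ ⧸ J)) → MvPowerSeries σ κ,
      ∀ k, Ideal.Quotient.mk J (f k) = b k :=
    ⟨fun k => (Ideal.Quotient.mk_surjective (b k)).choose,
      fun k => (Ideal.Quotient.mk_surjective (b k)).choose_spec⟩
  have hli : LinearIndependent L fun k => Φ (b k) := by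
    rw [Fintype.linearIndependent_iff]
    intro g hg k
    refine (Module.forall_dual_apply_eq_zero_iff κ (g k)).mp fun lam => ?_
    obtain ⟨Λ, hΛ⟩ := exists_hat (σ := σ) lam
    -- the `L`-relation lifts to `∑ g j • ψ (f j) ∈ J_L`
    have hrel : Ideal.Quotient.mk (J.map (map (algebraMap κ L)))
        (∑ j, g j • map (algebraMap κ L) (f j)) = ∑ j, g j • Φ (b j) := by
      rw [map_sum]
      refine Finset.sum_congr rfl fun j _ => ?_
      rw [← hf j, hΦ, ← Ideal.Quotient.mkₐ_eq_mk L, map_smul]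
    rw [hg, Ideal.Quotient.eq_zero_iff_mem] at hrel
    -- apply `λ̂`: a `κ`-relation among the `f j` modulo `J`
    have hJ : ∑ j, lam (g j) • f j ∈ J := by
      have := hat_mem hΛ J hrel
      rw [map_sum] at this
      simpa only [hat_smul_map hΛ] using this
    have hsum : Ideal.Quotient.mk J (∑ j, lam (g j) • f j) = ∑ j, lam (g j) • b j := by
      rw [map_sum]
      refine Finset.sum_congr rfl fun j _ => ?_
      rw [← hf j, ← Ideal.Quotient.mkₐ_eq_mk κ, map_smul]
    rw [Ideal.Quotient.eq_zero_iff_mem.mpr hJ] at hsum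
    exact Fintype.linearIndependent_iff.mp b.linearIndependent _ hsum.symm k
  simpa using hli.fintype_card_le_finrank

/-- **The colength is invariant under extension of the ground field**:
`dim_κ (R_κ ⧸ J) = dim_L (R_L ⧸ J.map ψ)` (both `0` in the infinite case). [folklore] -/
theorem finrank_eq_map (J : Ideal (MvPowerSeries σ κ)) :
    finrank κ (MvPowerSeries σ κ ⧸ J) =
      finrank L (MvPowerSeries σ L ⧸ J.map (map (algebraMap κ L))) := by
  obtain ⟨Φ, hΦ⟩ := exists_quotMap (L := L) J
  by_cases hfin : Module.Finite κ (MvPowerSeries σ κ ⧸ J)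
  · haveI := (finite_iff_map (L := L) J).mp hfin
    obtain ⟨N, hN⟩ :=
      exists_maximalIdeal_pow_le_of_finite_quotient (J.map (map (algebraMap κ L)))
    exact le_antisymm (le_finrank_map hΦ) (finrank_map_le hΦ hN)
  · have hfin' : ¬ Module.Finite L (MvPowerSeries σ L ⧸ J.map (map (algebraMap κ L))) :=
      fun h => hfin ((finite_iff_map J).mpr h)
    rw [finrank_of_not_finite hfin, finrank_of_not_finite hfin']

/-- `finite_iff_map` against a named extended ideal. [folklore] -/
theorem finite_iff {J : Ideal (MvPowerSeries σ κ)} {JL : Ideal (MvPowerSeries σ L)}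
    (h : JL = J.map (map (algebraMap κ L))) :
    Module.Finite κ (MvPowerSeries σ κ ⧸ J) ↔ Module.Finite L (MvPowerSeries σ L ⧸ JL) := by
  subst h
  exact finite_iff_map J

/-- `finrank_eq_map` against a named extended ideal. [folklore] -/
theorem finrank_eq {J : Ideal (MvPowerSeries σ κ)} {JL : Ideal (MvPowerSeries σ L)}
    (h : JL = J.map (map (algebraMap κ L))) :
    finrank κ (MvPowerSeries σ κ ⧸ J) = finrank L (MvPowerSeries σ L ⧸ JL) := by
  subst h
  exact finrank_eq_map J

end Finite

end BaseChange

end Summit.ResolutionOfSingularities.ResolutionOfSingularities.Theorems.JacobianBudget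

end
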